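/- Fleet lead `ym-wcr-19456-p1`, route `WeakCouplingRates`, crux `ColdBoxTwoPointFloorW` (stmt-QuantumFields-19608). -/
import Summits.QuantumFields.YangMills.Theorems.WeakCouplingRatesDefs
import Literature.MathematicalPhysics.QuantumLattice.LatticeGaugeDLRGibbsProofs

/-!
# Crux `ColdBoxTwoPointFloor(W)`, piece S3c-ii step 1: the TEMPORAL-FOREST GAUGE of the cold-wall box — gauge function,
# gauge-fixed configuration, box/free configurations (objects and measurability)

The one-scale expansion of the cold-wall box state `boxState ρ β H` (crux BOX / BOX_W of route `WeakCouplingRates`) is written in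
the temporal gauge on the forest `{(x, e₀) : x interior}` of the cold box `Λ = boxEdges 4 (2H+1)` — the same forest that defines the
Dirichlet Gaussian D1' (`dirFreeEdges`, `boxDirichlet`).  This file builds the gauge fixing à la Chatterjee (arXiv:1602.01222 §9,
there for the COMB tree of a free box; tree file `LatticeAxialGauge.lean`), here for the temporal forest of the COLD-WALL box:

* `tProd U m x` — the ordered temporal product `U(x,e₀)U(x+e₀,e₀)⋯U(x+(m−1)e₀,e₀)`; `forestGauge H U x` — at an interior vertex the
  inverse temporal holonomy from `x` up to the top face, `1` elsewhere; `forestFix H U = g_U · U` (`gaugeTransformZd`);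
* `forestGauge_add_single` (the recursion `g(x+e₀) = g(x)U(x,e₀)` across forest edges), `forestFix_forest` (**the gauge-fixed
  configuration is `1` on the forest**), `forestGauge_congr` (the gauge function only reads forest links), measurability;
* box level: `ColdCfg H = G^Λ`, `ColdFreeCfg H = G^{Λ ∖ forest}`, `coldExt` (extension by the cold wall, `= glueWith Λ · 1`),
  `coldExt₁` (extension of free data by `1` on the forest), `coldFixBox`, `coldFreePart`,
  `coldFixBox_eq_coldExt₁_coldFreePart`, measurability.
The measure-theoretic statements (free part is product-Haar distributed; `boxState` expectations as free-link integrals) are in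
the sibling file `WeakCouplingRatesColdBoxForestGaugeIntegral.lean`.  Everything proved; standard axioms; the `def`s are the
gauge-fixing maps (no `Prop`-valued definition).  NOT a statement about the mass gap.
-/

set_option autoImplicit false

noncomputable section

open MeasureTheory Finset Function
open Literature.Probability.LatticeModels (Site glueWith glueWith_apply_mem glueWith_apply_not_mem
  measurable_glueWith)
open Literature.MathematicalPhysics.QuantumLattice
open Literature.MathematicalPhysics.QuantumFieldTheory
open Literature.MathematicalPhysics.QuantumFieldTheory.AxialGauge

namespace Summit.QuantumFields.YangMills.Theorems.WeakCouplingRates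

variable {G : Type*} [Group G]

/-! ## The temporal forest gauge of the cold box `{0,…,2H}⁴` -/

/-- The ordered temporal product upward: `tProd U m x = U(x,e₀) · U(x+e₀,e₀) ⋯ U(x+(m−1)e₀, e₀)`. -/
def tProd (U : LGConfig 4 G) : ℕ → Site 4 → G
  | 0, _ => 1
  | m + 1, x => U (x, 0) * tProd U m (x + Pi.single 0 1)

/-- **The temporal-forest gauge function** of the cold box of half-side `H`: at an INTERIOR vertex `x` (all coordinates in
`[1, 2H−1]`) it is the inverse of the temporal holonomy from `x` up to the top face `x₀ = 2H`; elsewhere `1` (boundary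
vertices are identified through the frozen outside and carry no gauge freedom). -/
def forestGauge (H : ℕ) (U : LGConfig 4 G) (x : Site 4) : G :=
  if (∀ k : Fin 4, 1 ≤ x k ∧ x k + 1 ≤ 2 * (H : ℤ)) then (tProd U (2 * (H : ℤ) - x 0).toNat x)⁻¹ else 1

/-- The temporal-forest gauge-fixed configuration `g_U · U`. -/
def forestFix (H : ℕ) (U : LGConfig 4 G) : LGConfig 4 G := gaugeTransformZd (forestGauge H U) U

variable {H : ℕ}

/-- Off the interior the gauge function is `1`. -/
theorem forestGauge_of_not_interior (U : LGConfig 4 G) {x : Site 4}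
    (hx : ¬ ∀ k : Fin 4, 1 ≤ x k ∧ x k + 1 ≤ 2 * (H : ℤ)) : forestGauge H U x = 1 := by
  rw [forestGauge, if_neg hx]

/-- **Recursion of the forest gauge across a forest edge**: for interior `x`, `g(x + e₀) = g(x) · U(x, e₀)`. -/
theorem forestGauge_add_single (U : LGConfig 4 G) {x : Site 4} (hx : ∀ k : Fin 4, 1 ≤ x k ∧ x k + 1 ≤ 2 * (H : ℤ)) :
    forestGauge H U (x + Pi.single 0 1) = forestGauge H U x * U (x, 0) := by
  have h0 := hx 0
  obtain ⟨m, hm⟩ : ∃ m : ℕ, (2 * (H : ℤ) - x 0).toNat = m + 1 := ⟨(2 * (H : ℤ) - x 0).toNat - 1, by omega⟩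
  have hR : forestGauge H U x = (U (x, 0) * tProd U m (x + Pi.single 0 1))⁻¹ := by
    rw [forestGauge, if_pos hx, hm, tProd]
  rw [hR]
  by_cases hx' : ∀ k : Fin 4, 1 ≤ (x + Pi.single (0 : Fin 4) (1 : ℤ) : Site 4) k ∧
      (x + Pi.single (0 : Fin 4) (1 : ℤ) : Site 4) k + 1 ≤ 2 * (H : ℤ)
  · have hm' : (2 * (H : ℤ) - (x + Pi.single (0 : Fin 4) (1 : ℤ) : Site 4) 0).toNat = m := by
      simp only [Pi.add_apply, Pi.single_eq_same]; omega
    rw [forestGauge, if_pos hx', hm']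
    group
  · have htop : x 0 + 1 + 1 > 2 * (H : ℤ) := by
      by_contra hle
      apply hx'
      intro k
      by_cases hk : k = 0
      · subst hk; simp only [Pi.add_apply, Pi.single_eq_same]; omega
      · simp only [Pi.add_apply, Pi.single_eq_of_ne hk, add_zero]; exact hx k
    have hm0 : m = 0 := by omega
    subst hm0
    rw [forestGauge, if_neg hx', tProd]
    group

/-- **The gauge-fixed configuration is `1` on the forest edges.** -/
theorem forestFix_forest (U : LGConfig 4 G) {x : Site 4} (hx : ∀ k : Fin 4, 1 ≤ x k ∧ x k + 1 ≤ 2 * (H : ℤ)) :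
    forestFix H U (x, 0) = 1 := by
  simp only [forestFix, gaugeTransformZd, forestGauge_add_single U hx]
  group

/-- The gauge-fixed configuration elsewhere. -/
theorem forestFix_apply (U : LGConfig 4 G) (e : Literature.MathematicalPhysics.QuantumLattice.ZdEdge 4) :
    forestFix H U e = forestGauge H U e.1 * U e * (forestGauge H U (e.1 + Pi.single e.2 1))⁻¹ := rfl

/-- `tProd U m x` only reads the temporal edges `(x + k e₀, e₀)`, `k < m`. -/
theorem tProd_congr {U U' : LGConfig 4 G} :
    ∀ (m : ℕ) (x : Site 4), (∀ k : ℕ, k < m → U (x + Pi.single 0 (k : ℤ), 0) = U' (x + Pi.single 0 (k : ℤ), 0)) →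
      tProd U m x = tProd U' m x := by
  intro m
  induction m with
  | zero => intro _ _; rfl
  | succ m ih =>
    intro x h
    simp only [tProd]
    have h0 := h 0 (Nat.succ_pos m)
    simp only [Nat.cast_zero, Pi.single_zero, add_zero] at h0
    rw [h0, ih (x + Pi.single 0 1) fun k hk => ?_]
    have := h (k + 1) (by omega)
    rw [show x + Pi.single (0 : Fin 4) (1 : ℤ) + Pi.single 0 (k : ℤ) = x + Pi.single 0 ((k + 1 : ℕ) : ℤ) by
      rw [add_assoc, ← Pi.single_add]; push_cast; ring_nf]
    exact this

/-- **The forest gauge only reads forest edges.** -/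
theorem forestGauge_congr {U U' : LGConfig 4 G}
    (h : ∀ x : Site 4, (∀ k : Fin 4, 1 ≤ x k ∧ x k + 1 ≤ 2 * (H : ℤ)) → U (x, 0) = U' (x, 0)) (x : Site 4) :
    forestGauge H U x = forestGauge H U' x := by
  by_cases hx : ∀ k : Fin 4, 1 ≤ x k ∧ x k + 1 ≤ 2 * (H : ℤ)
  · rw [forestGauge, forestGauge, if_pos hx, if_pos hx, tProd_congr _ x fun k hk => h _ fun j => ?_]
    have := hx j; have := hx 0
    have hk' : (k : ℤ) < 2 * (H : ℤ) - x 0 := by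
      have : ((2 * (H : ℤ) - x 0).toNat : ℤ) = 2 * (H : ℤ) - x 0 := Int.toNat_of_nonneg (by omega)
      omega
    by_cases hj : j = 0
    · subst hj; simp only [Pi.add_apply, Pi.single_eq_same]; omega
    · simp only [Pi.add_apply, Pi.single_eq_of_ne hj, add_zero]; omega
  · rw [forestGauge_of_not_interior U hx, forestGauge_of_not_interior U' hx]

/-! ### Measurability -/

section Meas

variable [MeasurableSpace G] [TopologicalSpace G] [IsTopologicalGroup G] [BorelSpace G] [SecondCountableTopology G]

/-- `tProd · m x` is measurable in the configuration. -/
theorem measurable_tProd : ∀ (m : ℕ) (x : Site 4), Measurable fun U : LGConfig 4 G => tProd U m x := by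
  intro m
  induction m with
  | zero => intro x; simp only [tProd]; exact measurable_const
  | succ m ih => intro x; simp only [tProd]; exact (measurable_pi_apply _).mul (ih _)

/-- The forest gauge function is measurable in the configuration. -/
theorem measurable_forestGauge (x : Site 4) : Measurable fun U : LGConfig 4 G => forestGauge H U x := by
  by_cases hx : ∀ k : Fin 4, 1 ≤ x k ∧ x k + 1 ≤ 2 * (H : ℤ)
  · simp only [forestGauge, if_pos hx]; exact (measurable_tProd _ _).inv
  · simp only [forestGauge, if_neg hx]; exact measurable_const

end Meas

/-! ## Gauge fixing on the cold box `Λ = boxEdges 4 (2H+1)`: the free part is product-Haar distributed -/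

section Box

variable (H)

/-- Configurations on the edges of the cold box `Λ = boxEdges 4 (2H+1)`. -/
abbrev ColdCfg : Type _ := ↥(boxEdges 4 (2 * H + 1)) → G

/-- Configurations on the FREE (non-forest) edges of the cold box. -/
abbrev ColdFreeCfg : Type _ :=
  {e : ↥(boxEdges 4 (2 * H + 1)) // ¬ (e.1.2 = 0 ∧ ∀ k : Fin 4, 1 ≤ e.1.1 k ∧ e.1.1 k + 1 ≤ 2 * (H : ℤ))} → G

variable {H}

/-- Extension of a cold-box configuration by the cold wall `1` (= `glueWith Λ u 1`). -/
def coldExt (u : ColdCfg (G := G) H) : LGConfig 4 G := glueWith (boxEdges 4 (2 * H + 1)) u (fun _ => 1)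

/-- Extension of a free configuration by `1` on the forest. -/
def coldExt₁ (v : ColdFreeCfg (G := G) H) : ColdCfg (G := G) H := fun e =>
  if h : (e.1.2 = 0 ∧ ∀ k : Fin 4, 1 ≤ e.1.1 k ∧ e.1.1 k + 1 ≤ 2 * (H : ℤ)) then 1 else v ⟨e, h⟩

/-- The forest-gauge-fixed cold-box configuration. -/
def coldFixBox (u : ColdCfg (G := G) H) : ColdCfg (G := G) H :=
  fun e => forestFix H (coldExt u) e.1

/-- Its free part. -/
def coldFreePart (u : ColdCfg (G := G) H) : ColdFreeCfg (G := G) H := fun e => coldFixBox u e.1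

/-- `coldExt u` on a box edge. -/
theorem coldExt_apply_mem (u : ColdCfg (G := G) H) (e : ↥(boxEdges 4 (2 * H + 1))) : coldExt u e.1 = u e := by
  rw [coldExt, glueWith_apply_mem _ _ _ e.2]

/-- `coldExt u` off the box (the cold wall). -/
theorem coldExt_apply_not_mem (u : ColdCfg (G := G) H) {e : Literature.MathematicalPhysics.QuantumLattice.ZdEdge 4}
    (he : e ∉ boxEdges 4 (2 * H + 1)) : coldExt u e = 1 := by
  rw [coldExt, glueWith_apply_not_mem _ _ _ he]

/-- The gauge-fixed box configuration is the forest-extension of its free part. -/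
theorem coldFixBox_eq_coldExt₁_coldFreePart (u : ColdCfg (G := G) H) : coldFixBox u = coldExt₁ (coldFreePart u) := by
  funext e
  by_cases h : (e.1.2 = 0 ∧ ∀ k : Fin 4, 1 ≤ e.1.1 k ∧ e.1.1 k + 1 ≤ 2 * (H : ℤ))
  · rw [coldExt₁, dif_pos h, coldFixBox]
    obtain ⟨⟨x, i⟩, he⟩ := e
    obtain ⟨hi, hx⟩ := h
    simp only at hi hx
    subst hi
    exact forestFix_forest _ hx
  · rw [coldExt₁, dif_neg h]; rfl

section MeasBox

variable [MeasurableSpace G] [TopologicalSpace G] [IsTopologicalGroup G] [BorelSpace G] [SecondCountableTopology G]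

omit [TopologicalSpace G] [IsTopologicalGroup G] [BorelSpace G] [SecondCountableTopology G] in
/-- `coldExt` is measurable. -/
theorem measurable_coldExt : Measurable (coldExt (G := G) (H := H)) := measurable_glueWith _ _

omit [TopologicalSpace G] [IsTopologicalGroup G] [BorelSpace G] [SecondCountableTopology G] in
/-- `coldExt₁` is measurable. -/
theorem measurable_coldExt₁ : Measurable (coldExt₁ (G := G) (H := H)) := by
  refine measurable_pi_lambda _ fun e => ?_
  by_cases h : (e.1.2 = 0 ∧ ∀ k : Fin 4, 1 ≤ e.1.1 k ∧ e.1.1 k + 1 ≤ 2 * (H : ℤ))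
  · simp only [coldExt₁, dif_pos h]; exact measurable_const
  · simp only [coldExt₁, dif_neg h]; exact measurable_pi_apply _

/-- `coldFixBox` is measurable. -/
theorem measurable_coldFixBox : Measurable (coldFixBox (G := G) (H := H)) := by
  refine measurable_pi_lambda _ fun e => ?_
  change Measurable fun u : ColdCfg H => forestFix H (coldExt u) e.1
  simp only [forestFix_apply]
  exact (((measurable_forestGauge _).comp measurable_coldExt).mul
    ((measurable_pi_apply _).comp measurable_coldExt)).mul
    ((measurable_forestGauge _).comp measurable_coldExt).inv

/-- `coldFreePart` is measurable. -/
theorem measurable_coldFreePart : Measurable (coldFreePart (G := G) (H := H)) :=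
  measurable_pi_lambda _ fun e => (measurable_pi_apply e.1).comp measurable_coldFixBox

end MeasBox

end Box

end Summit.QuantumFields.YangMills.Theorems.WeakCouplingRates

end
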